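import Literature.AlgebraicTopology.FundamentalGroup.VanKampenKernel
import Mathlib.GroupTheory.Coprod.Basic
import HarnessLib

/-!
# The Seifert–van Kampen theorem for two open sets (pushout and free-product forms)

Topic `Literature/AlgebraicTopology/FundamentalGroup`.  This file **proves** the Seifert–van
Kampen theorem for a cover of a space `Y` by two open sets `U`, `T` with `x₀ ∈ U ∩ T` and
`U`, `T`, `U ∩ T` path connected, in the two forms in which it is used to *compute*
fundamental groups:

* **Universal-property (pushout) form** (Hatcher, *Algebraic Topology* (2002), Thm. 1.20, two
  sets `A₁ = U`, `A₂ = T`; equivalently Brown's groupoid formulation restricted to one base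
  point): for every group `G` and homomorphisms `φ_U : π₁(U, x₀) → G`, `φ_T : π₁(T, x₀) → G`
  agreeing on the classes of the loops at `x₀` inside `U ∩ T` there is a **unique**
  homomorphism `Φ : π₁(Y, x₀) → G` with `Φ ∘ (i_U)_* = φ_U`, `Φ ∘ (i_T)_* = φ_T`
  (`PushoutData.lift`, `PushoutData.lift_comp_inclHom_U`, `PushoutData.lift_comp_inclHom_T`,
  `PushoutData.lift_unique`, `PushoutData.existsUnique_hom`, unbundled
  `existsUnique_hom_of_cover`).  That is, `π₁(Y, x₀)` with `(i_U)_*, (i_T)_*` is the pushout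
  of `π₁(U, x₀) ← π₁(U ∩ T, x₀) → π₁(T, x₀)` in the category of groups, i.e. Hatcher's
  `π₁(Y) ≅ (π₁(U) ∗ π₁(T)) / N`.
* **Generation** (Hatcher, Lemma 1.15, two sets): `π₁(Y, x₀)` is generated by the images of
  `π₁(U, x₀)` and `π₁(T, x₀)` (`PushoutData.closure_range_inclHom_eq_top`,
  `closure_range_inclHom_union_eq_top`), whence the uniqueness statement
  `PushoutData.hom_ext`.
* **Free-product form** (Thm. 1.20 with `π₁(U ∩ T) = 1`): if moreover `U ∩ T` is simply
  connected, the inclusions induce an isomorphism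
  `fundamentalGroupEquivCoprod : π₁(Y, x₀) ≃* π₁(U, x₀) ∗ π₁(T, x₀)` onto the free product
  `Monoid.Coprod` (with its values on the two factors, `fundamentalGroupEquivCoprod_inclHom_left`
  etc.).

The kernel half of Thm. 1.20 in its "normal closure" phrasing is the sibling file
`VanKampenKernel.lean`, whose grid machinery (`liftPath`, `HomotopicWithin`,
`homotopicWithin_of_square`, `gc`, `sq`, `exists_grid`, `hEdge`, `vEdge`, `rowProd`) is reused
here.

## Proof

Hatcher's proof of Thm. 1.20, organised (as in `VanKampenKernel.lean`) so that no combinatorics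
of factorisations or reduced words is needed — the homomorphism `Φ` is *constructed* directly
and shown to be well defined by the grid argument:

* For every `y ∈ Y` choose a connecting path `conn y` from `x₀` (`PushoutData.conn`): constant
  if `y = x₀`, inside `U ∩ T` if `y ∈ U ∩ T`, inside `U` (resp. `T`) otherwise.  To a path `E`
  running in `U` attach the *label* `φ_U [conn · E · conn⁻¹] ∈ G`, to a path running in `T` the
  label `φ_T [conn · E · conn⁻¹]`; on paths inside `U ∩ T` the two agree by the compatibility
  of `φ_U`, `φ_T` (`PushoutData.plab_pieceU_eq_plab_pieceT`), so a path running in `U` or in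
  `T` has a well-defined label `lab E` (`PushoutData.lab`).  Labels are multiplicative along
  concatenation inside a piece and invariant under homotopies inside a piece
  (`PushoutData.lab_trans`, `PushoutData.lab_congr`), and constant paths have label `1`.
* The *label of a path* `E` of `Y` (`PushoutData.pathLabel`) is the product of the labels of
  the edges `E|[j/n, (j+1)/n]` of an *admissible* subdivision (every edge inside `U` or inside
  `T`; these exist by the Lebesgue number lemma, `PushoutData.exists_adm`).  It does not depend
  on the subdivision: refining an admissible subdivision does not change the product
  (`PushoutData.pathProd_mul`, by telescoping inside a piece, `PushoutData.pathProd_eq_lab`), and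
  two subdivisions have a common refinement.
* It is a homotopy invariant (`PushoutData.pathLabel_eq_of_homotopic`): for a homotopy `F` rel
  end points and a grid fine enough that every square goes into `U` or into `T`
  (`exists_grid`), the edge labels satisfy "bottom · right = left · top" on every square (square
  lemma plus the label calculus of that piece) and are trivial on the two side columns, so the
  bottom and top row products agree (`rowProd_eq_rowProd_of_grid`).
* It is (anti-)multiplicative under concatenation (`PushoutData.pathLabel_trans`: the `2n`-grid
  of `E₁ · E₂` consists of the `n`-grids of `E₁` and `E₂`), so it defines a homomorphism
  `Φ = PushoutData.lift : π₁(Y, x₀) → G` (products in `π₁` are reversed concatenations,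
  `FundamentalGroup.mul_def`), and on a loop inside `U` it is `φ_U` of its class because
  `conn x₀` is constant (`PushoutData.lift_inclHom_U`).
* Generation: the same telescoping in `Y` itself shows that the class of a loop is the product
  of the classes of the loops `conn · E|[j/n, (j+1)/n] · conn⁻¹`, each inside `U` or `T`
  (`PushoutData.loopProd_self`), whence `closure = ⊤`, uniqueness of `Φ`, and the free-product
  form by comparing `Φ` for `G = π₁(U) ∗ π₁(T)` with `(i_U)_* ∗ (i_T)_*` (`Monoid.Coprod.lift`).

## Main statements

* `PushoutData` (the datum), `PushoutData.lift`, `PushoutData.lift_comp_inclHom_U`,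
  `PushoutData.lift_comp_inclHom_T`, `PushoutData.hom_ext`, `PushoutData.lift_unique`,
  `PushoutData.existsUnique_hom`, `existsUnique_hom_of_cover` — Thm. 1.20, pushout form;
* `PushoutData.closure_range_inclHom_eq_top`, `closure_range_inclHom_union_eq_top` — Lemma 1.15;
* `fundamentalGroupEquivCoprod` (+ `_inclHom_left`, `_inclHom_right`, `_symm_inl`, `_symm_inr`)
  — Thm. 1.20, free-product form for simply connected `U ∩ T`.

## Sources

* A. Hatcher, *Algebraic Topology*, Cambridge Univ. Press (2002), §1.2: Lemma 1.15
  (generation; PDF p. 49 of the held copy `book:hatchernd-algebraic-topology`), Thm. 1.20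
  (van Kampen's theorem, PDF p. 60) and its proof (factorisations, the paths `g_v`, the grid on
  `I × I`; PDF pp. 62–64). [HatcherAT2002]
* H. Seifert, *Konstruktion dreidimensionaler geschlossener Räume*, Ber. Sächs. Akad. Wiss. 83
  (1931); E. R. van Kampen, *On the connection between the fundamental groups of some related
  spaces*, Amer. J. Math. 55 (1933) — the original sources (not used directly).
* R. Brown, *Topology and Groupoids* (2006), §6.7 — the universal-property formulation.
* Mathlib: `FundamentalGroup` (`mul_def : p * q = q.trans p`), `Path.Homotopic.Quotient`,
  `Path.subpath` / `Path.Homotopy.subpathTransSubpath` (`Mathlib.Topology.Subpath`),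
  `Monoid.Coprod` (`lift`, `hom_ext`), `MonoidHom.eq_of_eqOn_dense`, `MonoidHom.toMulEquiv`,
  `IsSimplyConnected` / `isSimplyConnected_iff_exists_homotopy_refl_forall_mem`.  Mathlib (this
  pin) has no form of the Seifert–van Kampen theorem for fundamental groups (searched
  `vanKampen`, `VanKampen`, `Coprod` near `FundamentalGroup`).

## Design notes

* Openness of `U`, `T` and `U ∪ T = univ` are fields of the datum (the label of a path needs an
  admissible subdivision to exist).
* The label calculus is developed once for a `PushoutData.Piece` (a set containing `x₀`, stable
  under the connecting paths, with a homomorphism on its `π₁`) and applied to `U` and `T`.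
* All path identities are stated with free end points and pointwise hypotheses
  (`PushoutData.lab_congr_pt`, `Piece.plab_eq_of_lift`), which avoids casts.
* `_root_.FundamentalGroup` is written in full because the directory name shadows Mathlib's
  `FundamentalGroup` inside this namespace (CONVENTIONS.md §2).
* No declaration in this file uses `sorry`.
-/

noncomputable section

open Set Function unitInterval Topology

namespace Literature.AlgebraicTopology.FundamentalGroup

namespace VanKampen

variable {Y : Type*} [TopologicalSpace Y] {G : Type*} [Group G]

/-! ### Inclusions of subspaces on fundamental groups -/

/-- The inclusion of a subspace as a continuous map. [folklore] -/
abbrev incl (S : Set Y) : C(S, Y) := ⟨Subtype.val, continuous_subtype_val⟩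

/-- The homomorphism `i_* : π₁(S, x₀) → π₁(Y, x₀)` induced by the inclusion of a subspace
`S ∋ x₀`. [folklore] -/
def inclHom (S : Set Y) (x₀ : Y) (h : x₀ ∈ S) :
    _root_.FundamentalGroup S ⟨x₀, h⟩ →* _root_.FundamentalGroup Y x₀ :=
  _root_.FundamentalGroup.mapOfEq (incl S) rfl

/-- `i_*` on the class of a loop of the subspace is the class of the same loop in `Y`.
[folklore] -/
theorem inclHom_fromPath {S : Set Y} {x₀ : Y} (h : x₀ ∈ S) (δ : Path (⟨x₀, h⟩ : S) ⟨x₀, h⟩) :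
    inclHom S x₀ h (_root_.FundamentalGroup.fromPath (Path.Homotopic.Quotient.mk δ)) =
      _root_.FundamentalGroup.fromPath
        (Path.Homotopic.Quotient.mk (δ.map continuous_subtype_val)) := by
  rw [inclHom, _root_.FundamentalGroup.mapOfEq_apply]
  rfl

/-- `i_*` on the class of the lift of a loop of `Y` inside `S` is the class of the loop.
[folklore] -/
theorem inclHom_fromPath_liftPath {S : Set Y} {x₀ : Y} (h : x₀ ∈ S) (δ : Path x₀ x₀)
    (hδ : ∀ t, δ t ∈ S) :
    inclHom S x₀ h (_root_.FundamentalGroup.fromPath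
        (Path.Homotopic.Quotient.mk (liftPath S δ hδ))) =
      _root_.FundamentalGroup.fromPath (Path.Homotopic.Quotient.mk δ) := by
  rw [inclHom_fromPath]
  congr 2

/-! ### The datum -/

variable (Y G) in
/-- **The datum of the Seifert–van Kampen theorem for two open sets**: an open cover
`Y = U ∪ T`, a base point `x₀ ∈ U ∩ T` with `U`, `T` and `U ∩ T` path connected, and a
*cone* under `π₁(U, x₀) ← π₁(U ∩ T, x₀) → π₁(T, x₀)` with vertex a group `G`: homomorphisms
`φ_U : π₁(U, x₀) → G`, `φ_T : π₁(T, x₀) → G` agreeing on (the images of) the classes of the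
loops at `x₀` inside `U ∩ T` (Hatcher, *Algebraic Topology* (2002), Thm. 1.20, data of the
universal property of `π₁(U) *_{π₁(U ∩ T)} π₁(T)`). [cite: HatcherAT2002, Thm. 1.20] -/
structure PushoutData where
  /-- The first open piece. -/
  U : Set Y
  /-- The second open piece. -/
  T : Set Y
  /-- `U` is open. -/
  hUo : IsOpen U
  /-- `T` is open. -/
  hTo : IsOpen T
  /-- The two pieces cover. -/
  hcov : U ∪ T = univ
  /-- The base point. -/
  x₀ : Y
  /-- The base point lies in `U`. -/
  hxU : x₀ ∈ U
  /-- The base point lies in `T`. -/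
  hxT : x₀ ∈ T
  /-- `U` is path connected. -/
  hUpc : IsPathConnected U
  /-- `T` is path connected. -/
  hTpc : IsPathConnected T
  /-- `U ∩ T` is path connected. -/
  hmeet : IsPathConnected (U ∩ T)
  /-- The homomorphism on `π₁(U, x₀)`. -/
  φU : _root_.FundamentalGroup U ⟨x₀, hxU⟩ →* G
  /-- The homomorphism on `π₁(T, x₀)`. -/
  φT : _root_.FundamentalGroup T ⟨x₀, hxT⟩ →* G
  /-- `φ_U` and `φ_T` agree on the loops at `x₀` inside `U ∩ T`. -/
  compat : ∀ (δ : Path x₀ x₀) (hU : ∀ t, δ t ∈ U) (hT : ∀ t, δ t ∈ T),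
    φU (_root_.FundamentalGroup.fromPath (Path.Homotopic.Quotient.mk (liftPath U δ hU))) =
      φT (_root_.FundamentalGroup.fromPath (Path.Homotopic.Quotient.mk (liftPath T δ hT)))

namespace PushoutData

variable (D : PushoutData Y G)

/-- Every point of `Y` lies in `U` or in `T`. [folklore] -/
theorem mem_or_mem (y : Y) : y ∈ D.U ∨ y ∈ D.T := by
  have : y ∈ D.U ∪ D.T := by rw [D.hcov]; exact mem_univ y
  exact this

/-! ### Connecting paths -/

open Classical in
/-- Connecting path from the base point to `y` (Hatcher's paths `g_v`, proof of Thm. 1.20):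
the constant path if `y = x₀`, a path inside `U ∩ T` if `y ∈ U ∩ T`, inside `U` if
`y ∈ U ∖ T`, inside `T` if `y ∈ T ∖ U`. [cite: HatcherAT2002, proof of Thm. 1.20] -/
def conn (y : Y) : Path D.x₀ y :=
  if h₀ : y = D.x₀ then (Path.refl D.x₀).cast rfl h₀
  else if h₁ : y ∈ D.U ∩ D.T then (D.hmeet.joinedIn D.x₀ ⟨D.hxU, D.hxT⟩ y h₁).somePath
  else if h₂ : y ∈ D.U then (D.hUpc.joinedIn D.x₀ D.hxU y h₂).somePath
  else (D.hTpc.joinedIn D.x₀ D.hxT y ((D.mem_or_mem y).resolve_left h₂)).somePath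

/-- The connecting path of the base point is constant. [folklore] -/
theorem conn_self : D.conn D.x₀ = Path.refl D.x₀ := by
  unfold conn
  rw [dif_pos rfl]
  rfl

/-- Connecting paths to points of `U` run in `U`. [folklore] -/
theorem conn_mem_U {y : Y} (hy : y ∈ D.U) (t : I) : D.conn y t ∈ D.U := by
  unfold conn
  split_ifs with h₀ h₁
  · subst h₀; exact D.hxU
  · exact ((D.hmeet.joinedIn D.x₀ ⟨D.hxU, D.hxT⟩ y h₁).somePath_mem t).1
  · exact (D.hUpc.joinedIn D.x₀ D.hxU y hy).somePath_mem t

/-- Connecting paths to points of `T` run in `T`. [folklore] -/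
theorem conn_mem_T {y : Y} (hy : y ∈ D.T) (t : I) : D.conn y t ∈ D.T := by
  unfold conn
  split_ifs with h₀ h₁ h₂
  · subst h₀; exact D.hxT
  · exact ((D.hmeet.joinedIn D.x₀ ⟨D.hxU, D.hxT⟩ y h₁).somePath_mem t).2
  · exact absurd ⟨h₂, hy⟩ h₁
  · exact (D.hTpc.joinedIn D.x₀ D.hxT y ((D.mem_or_mem y).resolve_left h₂)).somePath_mem t

/-- The loop `conn(y) · E · conn(y')⁻¹` at the base point attached to a path `E` of `Y`
(Hatcher's factorisation device, proof of Thm. 1.20). [cite: HatcherAT2002, proof of Thm. 1.20] -/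
def loop {y y' : Y} (E : Path y y') : Path D.x₀ D.x₀ :=
  (D.conn y).trans (E.trans (D.conn y').symm)

/-- The loop of a path inside `U` runs in `U`. [folklore] -/
theorem loop_mem_U {y y' : Y} (E : Path y y') (hE : ∀ t, E t ∈ D.U) (t : I) :
    D.loop E t ∈ D.U := by
  have hy : y ∈ D.U := E.source ▸ hE 0
  have hy' : y' ∈ D.U := E.target ▸ hE 1
  exact trans_mem (D.conn_mem_U hy) (trans_mem hE (symm_mem (D.conn_mem_U hy'))) t

/-- The loop of a path inside `T` runs in `T`. [folklore] -/
theorem loop_mem_T {y y' : Y} (E : Path y y') (hE : ∀ t, E t ∈ D.T) (t : I) :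
    D.loop E t ∈ D.T := by
  have hy : y ∈ D.T := E.source ▸ hE 0
  have hy' : y' ∈ D.T := E.target ▸ hE 1
  exact trans_mem (D.conn_mem_T hy) (trans_mem hE (symm_mem (D.conn_mem_T hy'))) t

/-! ### Pieces and their labels -/

/-- One of the two pieces together with its homomorphism: a subset `S ∋ x₀` of `U ∪ T` stable
under the connecting paths, and a homomorphism `π₁(S, x₀) → G`.  The label calculus below is
developed once for a piece and applied to `U` and to `T`. [folklore] -/
structure Piece where
  /-- The underlying set. -/
  S : Set Y
  /-- The base point lies in the piece. -/
  mem : D.x₀ ∈ S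
  /-- The homomorphism on the fundamental group of the piece. -/
  φ : _root_.FundamentalGroup S ⟨D.x₀, mem⟩ →* G
  /-- Connecting paths to points of the piece stay in the piece. -/
  conn_mem : ∀ {y : Y}, y ∈ S → ∀ t, D.conn y t ∈ S

/-- The piece `U`. [folklore] -/
def pieceU : D.Piece where
  S := D.U
  mem := D.hxU
  φ := D.φU
  conn_mem := fun hy => D.conn_mem_U hy

/-- The piece `T`. [folklore] -/
def pieceT : D.Piece where
  S := D.T
  mem := D.hxT
  φ := D.φT
  conn_mem := fun hy => D.conn_mem_T hy

namespace Piece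

variable {D} (P : D.Piece)

/-- The base point of the subspace `S`. [folklore] -/
abbrev z₀ : P.S := ⟨D.x₀, P.mem⟩

/-- The loop of a path inside the piece runs in the piece. [folklore] -/
theorem loop_mem {y y' : Y} (E : Path y y') (hE : ∀ t, E t ∈ P.S) (t : I) :
    D.loop E t ∈ P.S := by
  have hy : y ∈ P.S := E.source ▸ hE 0
  have hy' : y' ∈ P.S := E.target ▸ hE 1
  exact trans_mem (P.conn_mem hy) (trans_mem hE (symm_mem (P.conn_mem hy'))) t

/-- The image under `φ` of the class of a loop of the subspace `S` at the base point.
[folklore] -/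
abbrev cls (δ : Path P.z₀ P.z₀) : G :=
  P.φ (_root_.FundamentalGroup.fromPath (Path.Homotopic.Quotient.mk δ))

/-- Loops with the same class have the same `cls`. [folklore] -/
theorem cls_eq_of_mk_eq {δ δ' : Path P.z₀ P.z₀}
    (h : (Path.Homotopic.Quotient.mk δ) = Path.Homotopic.Quotient.mk δ') :
    P.cls δ = P.cls δ' := by
  change P.φ _ = P.φ _
  rw [h]

/-- Homotopic loops have the same `cls`. [folklore] -/
theorem cls_congr {δ δ' : Path P.z₀ P.z₀} (h : δ.Homotopic δ') : P.cls δ = P.cls δ' :=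
  P.cls_eq_of_mk_eq (Path.Homotopic.Quotient.eq.2 h)

/-- `cls` is (anti-)multiplicative. [folklore] -/
theorem cls_trans (δ δ' : Path P.z₀ P.z₀) : P.cls (δ.trans δ') = P.cls δ' * P.cls δ := by
  change P.φ _ = P.φ _ * P.φ _
  rw [← map_mul, _root_.FundamentalGroup.mul_def]
  rfl

/-- `cls` of the constant loop is `1`. [folklore] -/
theorem cls_refl : P.cls (Path.refl P.z₀) = 1 := by
  change P.φ _ = 1
  rw [← map_one P.φ, _root_.FundamentalGroup.one_def]
  rfl

/-- The connecting path to a point of the piece, as a path of the subspace `S`. [folklore] -/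
def connZ (z : P.S) : Path P.z₀ z :=
  liftPath P.S (D.conn z) (P.conn_mem z.2)

/-- Points of `connZ`. [folklore] -/
@[simp]
theorem connZ_apply_coe (z : P.S) (t : I) : (P.connZ z t : Y) = D.conn z t := rfl

/-- **The label of a path inside the piece**: `φ` of the class of `conn · E · conn⁻¹`, a loop
of the subspace `S`. [cite: HatcherAT2002, proof of Thm. 1.20] -/
def plab {y y' : Y} (E : Path y y') (hE : ∀ t, E t ∈ P.S) : G :=
  P.cls (liftPath P.S (D.loop E) (P.loop_mem E hE))

/-- The label of a path with a given lift `EZ` to the subspace is `φ [connZ · EZ · connZ⁻¹]`.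
[folklore] -/
theorem plab_eq_of_lift {y y' : Y} (E : Path y y') (hE : ∀ t, E t ∈ P.S) {z z' : P.S}
    (EZ : Path z z') (h : ∀ t, (EZ t : Y) = E t) :
    P.plab E hE = P.cls ((P.connZ z).trans (EZ.trans (P.connZ z').symm)) := by
  obtain ⟨z, hz⟩ := z
  obtain ⟨z', hz'⟩ := z'
  obtain rfl : y = z := by rw [← E.source, ← h 0, EZ.source]
  obtain rfl : y' = z' := by rw [← E.target, ← h 1, EZ.target]
  unfold plab
  congr 1
  ext t
  change D.loop E t = _
  unfold loop
  rw [Path.trans_apply, Path.trans_apply]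
  split_ifs with h₁
  · rfl
  · rw [Path.trans_apply, Path.trans_apply]
    split_ifs with h₃
    · exact (h _).symm
    · rfl

/-- Labels are invariant under homotopies inside the piece. [folklore] -/
theorem plab_congr {y y' : Y} {E E' : Path y y'} (h : HomotopicWithin P.S E E')
    (hE : ∀ t, E t ∈ P.S) (hE' : ∀ t, E' t ∈ P.S) : P.plab E hE = P.plab E' hE' := by
  have hy : y ∈ P.S := E.source ▸ hE 0
  have hy' : y' ∈ P.S := E.target ▸ hE 1
  rw [P.plab_eq_of_lift E hE (liftPath P.S E hE) (fun _ => rfl),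
    P.plab_eq_of_lift E' hE' (liftPath P.S E' hE') (fun _ => rfl)]
  exact P.cls_congr (Path.Homotopic.hcomp (Path.Homotopic.refl _)
    (Path.Homotopic.hcomp (h.liftPath hE hE') (Path.Homotopic.refl _)))

/-- Labels are (anti-)multiplicative along concatenation inside the piece. [folklore] -/
theorem plab_trans {y y' y'' : Y} (E₁ : Path y y') (E₂ : Path y' y'') (h₁ : ∀ t, E₁ t ∈ P.S)
    (h₂ : ∀ t, E₂ t ∈ P.S) :
    P.plab (E₁.trans E₂) (trans_mem h₁ h₂) = P.plab E₂ h₂ * P.plab E₁ h₁ := by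
  rw [P.plab_eq_of_lift _ (trans_mem h₁ h₂) ((liftPath P.S E₁ h₁).trans (liftPath P.S E₂ h₂))
      (fun t => by rw [← liftPath_trans P.S E₁ E₂ h₁ h₂ (trans_mem h₁ h₂)]; rfl),
    P.plab_eq_of_lift E₁ h₁ (liftPath P.S E₁ h₁) (fun _ => rfl),
    P.plab_eq_of_lift E₂ h₂ (liftPath P.S E₂ h₂) (fun _ => rfl), ← P.cls_trans]
  apply P.cls_eq_of_mk_eq
  simp only [Path.Homotopic.Quotient.mk_trans, Path.Homotopic.Quotient.mk_symm,
    Path.Homotopic.Quotient.trans_assoc, symm_trans_cancel]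

/-- A path with constant value in the piece has label `1`. [folklore] -/
theorem plab_eq_one_of_const {y y' : Y} (E : Path y y') (hE : ∀ t, E t ∈ P.S) {c : Y}
    (hc : ∀ t, E t = c) : P.plab E hE = 1 := by
  have hcS : c ∈ P.S := hc 0 ▸ hE 0
  rw [P.plab_eq_of_lift E hE (Path.refl (⟨c, hcS⟩ : P.S)) (fun t => (hc t).symm), ← P.cls_refl]
  apply P.cls_eq_of_mk_eq
  simp only [Path.Homotopic.Quotient.mk_trans, Path.Homotopic.Quotient.mk_symm,
    Path.Homotopic.Quotient.mk_refl, Path.Homotopic.Quotient.refl_trans,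
    Path.Homotopic.Quotient.trans_symm]

/-- The label of a loop at the base point inside the piece is `φ` of its class: the
connecting path of `x₀` is constant. [folklore] -/
theorem plab_loop_at_base (δ : Path D.x₀ D.x₀) (hδ : ∀ t, δ t ∈ P.S) :
    P.plab δ hδ = P.cls (liftPath P.S δ hδ) := by
  rw [P.plab_eq_of_lift δ hδ (liftPath P.S δ hδ) (fun _ => rfl)]
  have hc : P.connZ P.z₀ = Path.refl P.z₀ := by
    ext t
    change (D.conn D.x₀ t : Y) = D.x₀
    rw [D.conn_self]
    rfl
  rw [hc, Path.refl_symm]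
  apply P.cls_eq_of_mk_eq
  simp only [Path.Homotopic.Quotient.mk_trans, Path.Homotopic.Quotient.mk_refl,
    Path.Homotopic.Quotient.refl_trans, Path.Homotopic.Quotient.trans_refl]

end Piece

/-! ### The label of an arbitrary path -/

open Classical in
/-- **The label of a path** `E` of `Y`: the `U`-label if `E` runs in `U`, else the `T`-label
if `E` runs in `T`, else `1` (junk). [cite: HatcherAT2002, proof of Thm. 1.20] -/
def lab {y y' : Y} (E : Path y y') : G :=
  if hU : ∀ t, E t ∈ D.U then D.pieceU.plab E hU
  else if hT : ∀ t, E t ∈ D.T then D.pieceT.plab E hT else 1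

/-- **Consistency**: on a path inside `U ∩ T` the `U`-label and the `T`-label agree (the
compatibility of `φ_U` and `φ_T` on `π₁(U ∩ T)`). [folklore] -/
theorem plab_pieceU_eq_plab_pieceT {y y' : Y} (E : Path y y') (hU : ∀ t, E t ∈ D.U)
    (hT : ∀ t, E t ∈ D.T) : D.pieceU.plab E hU = D.pieceT.plab E hT :=
  D.compat (D.loop E) (D.loop_mem_U E hU) (D.loop_mem_T E hT)

/-- The label of a path inside `U` is its `U`-label. [folklore] -/
theorem lab_eq_plab_U {y y' : Y} (E : Path y y') (hU : ∀ t, E t ∈ D.U) :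
    D.lab E = D.pieceU.plab E hU := by
  unfold lab
  rw [dif_pos hU]

/-- The label of a path inside `T` is its `T`-label. [folklore] -/
theorem lab_eq_plab_T {y y' : Y} (E : Path y y') (hT : ∀ t, E t ∈ D.T) :
    D.lab E = D.pieceT.plab E hT := by
  unfold lab
  split_ifs with hU
  · exact D.plab_pieceU_eq_plab_pieceT E hU hT
  · rfl

/-- The label of a path inside a piece is its label for that piece. [folklore] -/
theorem lab_eq_plab (P : D.Piece) (hP : P = D.pieceU ∨ P = D.pieceT) {y y' : Y} (E : Path y y')
    (hE : ∀ t, E t ∈ P.S) : D.lab E = P.plab E hE := by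
  rcases hP with rfl | rfl
  · exact D.lab_eq_plab_U E hE
  · exact D.lab_eq_plab_T E hE

/-- Pointwise equal paths have the same label. [folklore] -/
theorem lab_congr_pt {y y' w w' : Y} (E : Path y y') (E' : Path w w') (h : ∀ s, E s = E' s) :
    D.lab E = D.lab E' := by
  obtain rfl : y = w := by rw [← E.source, ← E'.source, h]
  obtain rfl : y' = w' := by rw [← E.target, ← E'.target, h]
  obtain rfl : E = E' := Path.ext (funext h)
  rfl

/-- Labels are (anti-)multiplicative along concatenation inside a piece. [folklore] -/
theorem lab_trans (P : D.Piece) (hP : P = D.pieceU ∨ P = D.pieceT) {y y' y'' : Y}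
    (E₁ : Path y y') (E₂ : Path y' y'') (h₁ : ∀ t, E₁ t ∈ P.S) (h₂ : ∀ t, E₂ t ∈ P.S) :
    D.lab (E₁.trans E₂) = D.lab E₂ * D.lab E₁ := by
  rw [D.lab_eq_plab P hP _ (trans_mem h₁ h₂), D.lab_eq_plab P hP _ h₁, D.lab_eq_plab P hP _ h₂]
  exact P.plab_trans E₁ E₂ h₁ h₂

/-- Labels are invariant under homotopies inside a piece. [folklore] -/
theorem lab_congr (P : D.Piece) (hP : P = D.pieceU ∨ P = D.pieceT) {y y' : Y} {E E' : Path y y'}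
    (h : HomotopicWithin P.S E E') : D.lab E = D.lab E' := by
  rw [D.lab_eq_plab P hP E h.left_mem, D.lab_eq_plab P hP E' h.right_mem]
  exact P.plab_congr h h.left_mem h.right_mem

/-- A constant path has label `1`. [folklore] -/
theorem lab_eq_one_of_const {y y' : Y} (E : Path y y') {c : Y} (hc : ∀ t, E t = c) :
    D.lab E = 1 := by
  rcases D.mem_or_mem c with hcU | hcT
  · have hE : ∀ t, E t ∈ D.U := fun t => (hc t).symm ▸ hcU
    rw [D.lab_eq_plab_U E hE]
    exact D.pieceU.plab_eq_one_of_const E hE hc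
  · have hE : ∀ t, E t ∈ D.T := fun t => (hc t).symm ▸ hcT
    rw [D.lab_eq_plab_T E hE]
    exact D.pieceT.plab_eq_one_of_const E hE hc

/-! ### Products of labels along a subdivided path -/

/-- Splitting a row product into two blocks. [folklore] -/
theorem rowProd_add (H : ℕ → ℕ → G) (i a b : ℕ) :
    rowProd H i (a + b) = rowProd (fun i j => H i (a + j)) i b * rowProd H i a := by
  induction b with
  | zero => simp
  | succ b ih => rw [Nat.add_succ, rowProd_succ, ih, rowProd_succ, mul_assoc]

/-- Row products depend only on the factors used. [folklore] -/
theorem rowProd_congr {H H' : ℕ → ℕ → G} {i i' : ℕ} (k : ℕ) (h : ∀ j, j < k → H i j = H' i' j) :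
    rowProd H i k = rowProd H' i' k := by
  induction k with
  | zero => rfl
  | succ k ih =>
    rw [rowProd_succ, rowProd_succ, h k k.lt_succ_self, ih fun j hj => h j (by omega)]

/-- The `j`-th edge of the `n`-fold subdivision of a path. [folklore] -/
abbrev edge {y y' : Y} (E : Path y y') (n j : ℕ) :
    Path (E (gc n j)) (E (gc n (j + 1))) :=
  E.subpath (gc n j) (gc n (j + 1))

/-- **The product of the labels** of the first `k` edges of the `n`-fold subdivision of a path
(reversed order). [cite: HatcherAT2002, proof of Thm. 1.20] -/
def pathProd {y y' : Y} (E : Path y y') (n k : ℕ) : G :=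
  rowProd (fun _ j => D.lab (edge E n j)) 0 k

/-- A subdivision of a path is *admissible* if every edge runs in `U` or in `T`. [folklore] -/
def Adm {y y' : Y} (E : Path y y') (n : ℕ) : Prop :=
  0 < n ∧ ∀ j, j < n → (∀ s, edge E n j s ∈ D.U) ∨ (∀ s, edge E n j s ∈ D.T)

/-- **Admissible subdivisions exist** (Lebesgue number lemma, via the grid lemma of
`VanKampenKernel.lean` applied to `(s, t) ↦ E t`). [folklore] -/
theorem exists_adm {y y' : Y} (E : Path y y') : ∃ n, D.Adm E n := by
  let F : C(I × I, Y) := ⟨fun p => E p.2, by fun_prop⟩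
  obtain ⟨n, hn, hsq⟩ := exists_grid F D.hUo D.hTo fun x => D.mem_or_mem _
  refine ⟨n, hn, fun j hj => ?_⟩
  rcases hsq 0 j hn hj with h | h
  · exact Or.inl fun s => h (hEdge_mem n 0 j s)
  · exact Or.inr fun s => h (hEdge_mem n 0 j s)

variable {D} in
/-- In an admissible subdivision every edge runs in one of the two pieces. [folklore] -/
theorem Adm.exists_piece {y y' : Y} {E : Path y y'} {n : ℕ} (h : D.Adm E n) {j : ℕ}
    (hj : j < n) : ∃ P : D.Piece, (P = D.pieceU ∨ P = D.pieceT) ∧ ∀ s, edge E n j s ∈ P.S := by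
  rcases h.2 j hj with hU | hT
  · exact ⟨D.pieceU, Or.inl rfl, hU⟩
  · exact ⟨D.pieceT, Or.inr rfl, hT⟩

/-! ### Arithmetic of grid coordinates under refinement -/

/-- Refining the grid: the `l`-th point of the `m`-fold subdivision of the `k`-th interval of
the `n`-grid is the `(k m + l)`-th point of the `n m`-grid. [folklore] -/
theorem convexComb_gc_gc {n m k l : ℕ} (hn : 0 < n) (hm : 0 < m) (hk : k < n) (hl : l ≤ m)
    (s : I) :
    Set.Icc.convexComb (gc n k) (gc n (k + 1)) (Set.Icc.convexComb (gc m l) (gc m (l + 1)) s) =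
      Set.Icc.convexComb (gc (n * m) (k * m + l)) (gc (n * m) (k * m + l + 1)) s ∨ l = m := by
  rcases Nat.lt_or_ge l m with hl' | hl'
  · left
    have hnm : 0 < n * m := Nat.mul_pos hn hm
    have h1 : k * m + l + 1 ≤ n * m := by nlinarith
    apply Subtype.ext
    simp only [Set.Icc.coe_convexComb, coe_gc_of_le hn hk.le, coe_gc_of_le hn hk,
      coe_gc_of_le hm hl'.le, coe_gc_of_le hm hl', coe_gc_of_le hnm (by omega : k * m + l ≤ n * m),
      coe_gc_of_le hnm h1]
    have hn' : (n : ℝ) ≠ 0 := by exact_mod_cast hn.ne'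
    have hm' : (m : ℝ) ≠ 0 := by exact_mod_cast hm.ne'
    push_cast
    field_simp
    ring
  · exact Or.inr (le_antisymm hl hl')

/-- Refining the grid, interior points: for `l < m` the two parametrisations agree. [folklore] -/
theorem convexComb_gc_gc_of_lt {n m k l : ℕ} (hn : 0 < n) (hm : 0 < m) (hk : k < n) (hl : l < m)
    (s : I) :
    Set.Icc.convexComb (gc n k) (gc n (k + 1)) (Set.Icc.convexComb (gc m l) (gc m (l + 1)) s) =
      Set.Icc.convexComb (gc (n * m) (k * m + l)) (gc (n * m) (k * m + l + 1)) s := by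
  have hnm : 0 < n * m := Nat.mul_pos hn hm
  have h1 : k * m + l + 1 ≤ n * m := by nlinarith
  apply Subtype.ext
  simp only [Set.Icc.coe_convexComb, coe_gc_of_le hn hk.le, coe_gc_of_le hn hk,
    coe_gc_of_le hm hl.le, coe_gc_of_le hm hl, coe_gc_of_le hnm (by omega : k * m + l ≤ n * m),
    coe_gc_of_le hnm h1]
  have hn' : (n : ℝ) ≠ 0 := by exact_mod_cast hn.ne'
  have hm' : (m : ℝ) ≠ 0 := by exact_mod_cast hm.ne'
  push_cast
  field_simp
  ring

/-- The edges of the refined subdivision are the edges of the subdivided edges. [folklore] -/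
theorem edge_mul_apply {y y' : Y} (E : Path y y') {n m k l : ℕ} (hn : 0 < n) (hm : 0 < m)
    (hk : k < n) (hl : l < m) (s : I) :
    edge E (n * m) (k * m + l) s = edge (edge E n k) m l s := by
  change E _ = E _
  rw [convexComb_gc_gc_of_lt hn hm hk hl s]

variable {D} in
/-- Admissibility is preserved under refinement. [folklore] -/
theorem Adm.mul {y y' : Y} {E : Path y y'} {n : ℕ} (h : D.Adm E n) {m : ℕ} (hm : 0 < m) :
    D.Adm E (n * m) := by
  refine ⟨Nat.mul_pos h.1 hm, fun J hJ => ?_⟩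
  have hJ' : J = J / m * m + J % m := (Nat.div_add_mod' J m).symm
  have hkn : J / m < n := Nat.div_lt_of_lt_mul (by rwa [Nat.mul_comm] at hJ)
  have hlm : J % m < m := Nat.mod_lt _ hm
  rw [hJ']
  rcases h.2 (J / m) hkn with hU | hT
  · exact Or.inl fun s => by rw [edge_mul_apply E h.1 hm hkn hlm s]; exact hU _
  · exact Or.inr fun s => by rw [edge_mul_apply E h.1 hm hkn hlm s]; exact hT _

/-! ### A path inside one piece: the product of the labels of its edges is its label -/

/-- **Telescoping inside a piece.** For a path `Q` running in a piece, the product of the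
labels of the first `l` edges of its `m`-fold subdivision is `φ [conn · Q|[0, l/m] · conn⁻¹]`.
[folklore] -/
theorem rowProd_edge_eq_cls (P : D.Piece) (hP : P = D.pieceU ∨ P = D.pieceT) {y y' : Y}
    (Q : Path y y') (hQ : ∀ t, Q t ∈ P.S) (m l : ℕ) :
    rowProd (fun _ j => D.lab (edge Q m j)) 0 l =
      P.cls ((P.connZ (liftPath P.S Q hQ (gc m 0))).trans
        (((liftPath P.S Q hQ).subpath (gc m 0) (gc m l)).trans
          (P.connZ (liftPath P.S Q hQ (gc m l))).symm)) := by
  set QZ := liftPath P.S Q hQ with hQZ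
  induction l with
  | zero =>
    rw [rowProd_zero, Path.subpath_self, ← P.cls_refl]
    apply P.cls_eq_of_mk_eq
    simp only [Path.Homotopic.Quotient.mk_trans, Path.Homotopic.Quotient.mk_symm,
      Path.Homotopic.Quotient.mk_refl, Path.Homotopic.Quotient.refl_trans,
      Path.Homotopic.Quotient.trans_symm]
  | succ l ih =>
    rw [rowProd_succ, ih]
    have hl : D.lab (edge Q m l) = P.cls ((P.connZ (QZ (gc m l))).trans
        ((QZ.subpath (gc m l) (gc m (l + 1))).trans (P.connZ (QZ (gc m (l + 1)))).symm)) := by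
      rw [D.lab_eq_plab P hP (edge Q m l) (fun s => hQ _)]
      exact P.plab_eq_of_lift _ _ _ (fun _ => rfl)
    rw [hl, ← P.cls_trans]
    apply P.cls_eq_of_mk_eq
    have hS : ∀ ρ : Path.Homotopic.Quotient (QZ (gc m (l + 1))) P.z₀,
        (Path.Homotopic.Quotient.mk (QZ.subpath (gc m 0) (gc m l))).trans
          ((Path.Homotopic.Quotient.mk (QZ.subpath (gc m l) (gc m (l + 1)))).trans ρ) =
        (Path.Homotopic.Quotient.mk (QZ.subpath (gc m 0) (gc m (l + 1)))).trans ρ := by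
      intro ρ
      rw [← Path.Homotopic.Quotient.trans_assoc, ← Path.Homotopic.Quotient.mk_trans,
        Path.Homotopic.Quotient.eq.2 ⟨Path.Homotopy.subpathTransSubpath QZ _ _ _⟩]
    simp only [Path.Homotopic.Quotient.mk_trans, Path.Homotopic.Quotient.mk_symm,
      Path.Homotopic.Quotient.trans_assoc, symm_trans_cancel, hS]

/-- **A path inside one piece**: the product of the labels of the edges of any subdivision is
the label of the path. [folklore] -/
theorem pathProd_eq_lab (P : D.Piece) (hP : P = D.pieceU ∨ P = D.pieceT) {y y' : Y}
    (Q : Path y y') (hQ : ∀ t, Q t ∈ P.S) {m : ℕ} (hm : 0 < m) :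
    D.pathProd Q m m = D.lab Q := by
  rw [pathProd, D.rowProd_edge_eq_cls P hP Q hQ m m, D.lab_eq_plab P hP Q hQ]
  symm
  apply P.plab_eq_of_lift
  intro t
  change Q _ = Q t
  rw [gc_zero, gc_self hm, Set.Icc.convexComb_zero_one]

/-! ### Refinement invariance -/

/-- **Refining an admissible subdivision does not change the product of labels** (each edge
running in a piece is replaced by the product over its sub-edges, which is its label by
`pathProd_eq_lab`). [folklore] -/
theorem pathProd_mul {y y' : Y} {E : Path y y'} {n : ℕ} (h : D.Adm E n) {m : ℕ} (hm : 0 < m) :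
    ∀ k, k ≤ n → D.pathProd E (n * m) (k * m) = D.pathProd E n k := by
  intro k
  induction k with
  | zero => intro; simp [pathProd]
  | succ k ih =>
    intro hk
    have hkn : k < n := hk
    obtain ⟨P, hP, hPS⟩ := h.exists_piece hkn
    have hkm : (k + 1) * m = k * m + m := by ring
    have e1 : D.pathProd E (n * m) ((k + 1) * m) =
        rowProd (fun _ j => D.lab (edge E (n * m) (k * m + j))) 0 m *
          D.pathProd E (n * m) (k * m) := by
      rw [hkm]
      exact rowProd_add _ 0 (k * m) m
    have e2 : D.pathProd E n (k + 1) = D.lab (edge E n k) * D.pathProd E n k := rfl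
    rw [e1, e2, ih hkn.le]
    congr 1
    rw [← D.pathProd_eq_lab P hP (edge E n k) hPS hm]
    exact rowProd_congr m fun j hj => D.lab_congr_pt _ _ fun s => edge_mul_apply E h.1 hm hkn hj s

/-- Refinement invariance, full products. [folklore] -/
theorem pathProd_mul_self {y y' : Y} {E : Path y y'} {n : ℕ} (h : D.Adm E n) {m : ℕ}
    (hm : 0 < m) : D.pathProd E (n * m) (n * m) = D.pathProd E n n :=
  D.pathProd_mul h hm n le_rfl

/-- **Two admissible subdivisions give the same product of labels** (pass to the common
refinement). [folklore] -/
theorem pathProd_eq_of_adm {y y' : Y} {E : Path y y'} {n n' : ℕ} (h : D.Adm E n)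
    (h' : D.Adm E n') : D.pathProd E n n = D.pathProd E n' n' := by
  rw [← D.pathProd_mul_self h h'.1, ← D.pathProd_mul_self h' h.1, Nat.mul_comm]

/-! ### Homotopy invariance: the grid argument -/

/-- **Grid lemma, two-row form.** Edge labels in a group satisfying the square relations
"bottom then right = left then top", with trivial labels on the left and right columns, have
the same product along the bottom row and along the top row. [folklore] -/
theorem rowProd_eq_rowProd_of_grid (n : ℕ) (H V : ℕ → ℕ → G)
    (rel : ∀ i j, i < n → j < n → V i (j + 1) * H i j = H (i + 1) j * V i j)
    (hl : ∀ i, i < n → V i 0 = 1) (hr : ∀ i, i < n → V i n = 1) :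
    rowProd H 0 n = rowProd H n n := by
  have sweep : ∀ i, i < n → ∀ k, k ≤ n →
      V i k * rowProd H i k = rowProd H (i + 1) k * V i 0 := by
    intro i hi k
    induction k with
    | zero => intro; simp
    | succ k ih =>
      intro hk
      rw [rowProd_succ, rowProd_succ, ← mul_assoc, rel i k hi (by omega), mul_assoc,
        ih (by omega), mul_assoc]
  have rows : ∀ i, i < n → rowProd H i n = rowProd H (i + 1) n := by
    intro i hi
    have := sweep i hi n le_rfl
    rwa [hr i hi, hl i hi, one_mul, mul_one] at this
  have down : ∀ i, i ≤ n → rowProd H 0 n = rowProd H i n := by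
    intro i
    induction i with
    | zero => intro; rfl
    | succ i ih => intro hi; rw [ih (by omega), rows i (by omega)]
  exact down n le_rfl

/-- A subdivision of the square is *fine* for a map `F` if every grid square is mapped into
`U` or into `T`. [folklore] -/
def Fine (F : C(I × I, Y)) (n : ℕ) : Prop :=
  0 < n ∧ ∀ i j, i < n → j < n → MapsTo F (sq n i j) D.U ∨ MapsTo F (sq n i j) D.T

/-- Fine subdivisions exist (Lebesgue number lemma, `exists_grid`). [folklore] -/
theorem exists_fine (F : C(I × I, Y)) : ∃ n, D.Fine F n :=
  exists_grid F D.hUo D.hTo fun x => D.mem_or_mem (F x)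

variable {D} in
/-- A subdivision fine for a homotopy is admissible for its initial path. [folklore] -/
theorem Fine.adm_left {y y' : Y} {E E' : Path y y'} (F : E.Homotopy E') {n : ℕ}
    (h : D.Fine F.toContinuousMap n) : D.Adm E n := by
  refine ⟨h.1, fun j hj => ?_⟩
  have key : ∀ s, edge E n j s = F.toContinuousMap (gc n 0, Set.Icc.convexComb (gc n j)
      (gc n (j + 1)) s) := fun s => by
    rw [gc_zero]; exact (F.apply_zero _).symm
  rcases h.2 0 j h.1 hj with hU | hT
  · exact Or.inl fun s => by rw [key]; exact hU (hEdge_mem n 0 j s)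
  · exact Or.inr fun s => by rw [key]; exact hT (hEdge_mem n 0 j s)

variable {D} in
/-- A subdivision fine for a homotopy is admissible for its final path. [folklore] -/
theorem Fine.adm_right {y y' : Y} {E E' : Path y y'} (F : E.Homotopy E') {n : ℕ}
    (h : D.Fine F.toContinuousMap n) : D.Adm E' n := by
  refine ⟨h.1, fun j hj => ?_⟩
  obtain ⟨m, rfl⟩ : ∃ m, n = m + 1 := ⟨n - 1, by omega⟩
  have key : ∀ s, edge E' (m + 1) j s = F.toContinuousMap (gc (m + 1) (m + 1),
      Set.Icc.convexComb (gc (m + 1) j) (gc (m + 1) (j + 1)) s) := fun s => by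
    rw [gc_self h.1]; exact (F.apply_one _).symm
  rcases h.2 m j m.lt_succ_self hj with hU | hT
  · exact Or.inl fun s => by rw [key]; exact hU (hEdge_succ_mem (m + 1) m j s)
  · exact Or.inr fun s => by rw [key]; exact hT (hEdge_succ_mem (m + 1) m j s)

/-- **Homotopy invariance.** For a homotopy `F` (rel endpoints) from `E` to `E'` and a
subdivision fine for `F`, the products of the labels of the edges of `E` and of `E'` agree:
grid squares mapped into a piece give the square relation by the square lemma and the label
calculus of that piece, and the side columns are constant paths. [cite: HatcherAT2002, proof of Thm. 1.20] -/
theorem pathProd_eq_of_homotopy {y y' : Y} {E E' : Path y y'} (F : E.Homotopy E') {n : ℕ}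
    (hF : D.Fine F.toContinuousMap n) : D.pathProd E n n = D.pathProd E' n n := by
  set Fc : C(I × I, Y) := F.toContinuousMap with hFc
  obtain ⟨hn, hsq⟩ := hF
  let H : ℕ → ℕ → G := fun i j => D.lab (hEdge Fc n i j)
  let V : ℕ → ℕ → G := fun i j => D.lab (vEdge Fc n i j)
  -- square relations
  have rel : ∀ i j, i < n → j < n → V i (j + 1) * H i j = H (i + 1) j * V i j := by
    intro i j hi hj
    -- the square `(i, j)` is mapped into a piece `P`
    obtain ⟨P, hP, hPS⟩ : ∃ P : D.Piece, (P = D.pieceU ∨ P = D.pieceT) ∧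
        MapsTo Fc (sq n i j) P.S := by
      rcases hsq i j hi hj with h | h
      · exact ⟨D.pieceU, Or.inl rfl, h⟩
      · exact ⟨D.pieceT, Or.inr rfl, h⟩
    have hbS : ∀ u, hEdge Fc n i j u ∈ P.S := fun u => hPS (hEdge_mem n i j u)
    have htS : ∀ u, hEdge Fc n (i + 1) j u ∈ P.S := fun u => hPS (hEdge_succ_mem n i j u)
    have hlS : ∀ u, vEdge Fc n i j u ∈ P.S := fun u => hPS (vEdge_mem n i j u)
    have hrS : ∀ u, vEdge Fc n i (j + 1) u ∈ P.S := fun u => hPS (vEdge_succ_mem n i j u)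
    have hw : HomotopicWithin P.S ((hEdge Fc n i j).trans (vEdge Fc n i (j + 1)))
        ((vEdge Fc n i j).trans (hEdge Fc n (i + 1) j)) := by
      refine homotopicWithin_of_square (Fc.comp (sqMap n i j)) (fun p => hPS (sqMap_mem n i j p))
        _ _ _ _ (fun u => ?_) (fun u => ?_) (fun u => ?_) (fun u => ?_)
      · rw [hEdge_apply, ContinuousMap.comp_apply, sqMap_apply, Set.Icc.convexComb_zero]
      · rw [vEdge_apply, ContinuousMap.comp_apply, sqMap_apply, Set.Icc.convexComb_one]
      · rw [vEdge_apply, ContinuousMap.comp_apply, sqMap_apply, Set.Icc.convexComb_zero]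
      · rw [hEdge_apply, ContinuousMap.comp_apply, sqMap_apply, Set.Icc.convexComb_one]
    have e := D.lab_congr P hP hw
    rw [D.lab_trans P hP _ _ hbS hrS, D.lab_trans P hP _ _ hlS htS] at e
    exact e
  -- side columns are constant paths
  have hleft : ∀ i, i < n → V i 0 = 1 := fun i _ =>
    D.lab_eq_one_of_const _ fun u => by rw [vEdge_apply, gc_zero]; exact F.source _
  have hright : ∀ i, i < n → V i n = 1 := fun i _ =>
    D.lab_eq_one_of_const _ fun u => by rw [vEdge_apply, gc_self hn]; exact F.target _
  have hgrid := rowProd_eq_rowProd_of_grid n H V rel hleft hright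
  -- bottom and top rows
  have hbot : rowProd H 0 n = D.pathProd E n n :=
    rowProd_congr n fun j _ => D.lab_congr_pt _ _ fun u => by
      rw [hEdge_apply, gc_zero]; exact F.apply_zero _
  have htop : rowProd H n n = D.pathProd E' n n :=
    rowProd_congr n fun j _ => D.lab_congr_pt _ _ fun u => by
      rw [hEdge_apply, gc_self hn]; exact F.apply_one _
  rw [← hbot, ← htop]
  exact hgrid

/-! ### The label of a path and of a homotopy class -/

/-- **The label of a path**: the product of the labels of the edges of some (any) admissible
subdivision. [cite: HatcherAT2002, proof of Thm. 1.20] -/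
def pathLabel {y y' : Y} (E : Path y y') : G :=
  D.pathProd E (Classical.choose (D.exists_adm E)) (Classical.choose (D.exists_adm E))

/-- The label of a path is computed by any admissible subdivision. [folklore] -/
theorem pathLabel_eq_pathProd {y y' : Y} {E : Path y y'} {n : ℕ} (h : D.Adm E n) :
    D.pathLabel E = D.pathProd E n n :=
  D.pathProd_eq_of_adm (Classical.choose_spec (D.exists_adm E)) h

/-- **Homotopic paths have the same label.** [cite: HatcherAT2002, proof of Thm. 1.20] -/
theorem pathLabel_eq_of_homotopic {y y' : Y} {E E' : Path y y'} (h : E.Homotopic E') :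
    D.pathLabel E = D.pathLabel E' := by
  obtain ⟨F⟩ := h
  obtain ⟨n, hF⟩ := D.exists_fine F.toContinuousMap
  rw [D.pathLabel_eq_pathProd (hF.adm_left F), D.pathLabel_eq_pathProd (hF.adm_right F)]
  exact D.pathProd_eq_of_homotopy F hF

/-- **The label of a path inside a piece** is its label for that piece. [folklore] -/
theorem pathLabel_eq_lab (P : D.Piece) (hP : P = D.pieceU ∨ P = D.pieceT) {y y' : Y}
    (E : Path y y') (hE : ∀ t, E t ∈ P.S) : D.pathLabel E = D.lab E := by
  have h1 : D.Adm E 1 := by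
    refine ⟨Nat.one_pos, fun j hj => ?_⟩
    rcases hP with rfl | rfl
    · exact Or.inl fun s => hE _
    · exact Or.inr fun s => hE _
  rw [D.pathLabel_eq_pathProd h1]
  exact D.pathProd_eq_lab P hP E hE Nat.one_pos

/-- **The label of a loop at the base point inside a piece is `φ` of its class.** [folklore] -/
theorem pathLabel_loop (P : D.Piece) (hP : P = D.pieceU ∨ P = D.pieceT) (δ : Path D.x₀ D.x₀)
    (hδ : ∀ t, δ t ∈ P.S) : D.pathLabel δ = P.cls (liftPath P.S δ hδ) := by
  rw [D.pathLabel_eq_lab P hP δ hδ, D.lab_eq_plab P hP δ hδ]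
  exact P.plab_loop_at_base δ hδ

/-- The label of a constant path is `1`. [folklore] -/
theorem pathLabel_refl (y : Y) : D.pathLabel (Path.refl y) = 1 := by
  rcases D.mem_or_mem y with hy | hy
  · rw [D.pathLabel_eq_lab D.pieceU (Or.inl rfl) _ (fun _ => hy)]
    exact D.lab_eq_one_of_const _ fun _ => rfl
  · rw [D.pathLabel_eq_lab D.pieceT (Or.inr rfl) _ (fun _ => hy)]
    exact D.lab_eq_one_of_const _ fun _ => rfl

/-! ### Concatenation: the edges of `E₁ · E₂` -/

/-- The parameter of the `J`-th edge of the `2n`-grid, as a real number. [folklore] -/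
theorem coe_convexComb_gc_mul_two {n J : ℕ} (hn : 0 < n) (hJ : J < n * 2) (s : I) :
    ((Set.Icc.convexComb (gc (n * 2) J) (gc (n * 2) (J + 1)) s : I) : ℝ) =
      ((J : ℝ) + s) / (n * 2) := by
  have hn2 : 0 < n * 2 := Nat.mul_pos hn two_pos
  rw [Set.Icc.coe_convexComb, coe_gc_of_le hn2 hJ.le, coe_gc_of_le hn2 hJ]
  have hn' : (n : ℝ) ≠ 0 := by exact_mod_cast hn.ne'
  push_cast
  field_simp
  ring

/-- The parameter of the `J`-th edge of the `n`-grid, as a real number. [folklore] -/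
theorem coe_convexComb_gc {n J : ℕ} (hn : 0 < n) (hJ : J < n) (s : I) :
    ((Set.Icc.convexComb (gc n J) (gc n (J + 1)) s : I) : ℝ) = ((J : ℝ) + s) / n := by
  rw [Set.Icc.coe_convexComb, coe_gc_of_le hn hJ.le, coe_gc_of_le hn hJ]
  have hn' : (n : ℝ) ≠ 0 := by exact_mod_cast hn.ne'
  push_cast
  field_simp
  ring

/-- The first half of the `2n`-fold subdivision of `E₁ · E₂` consists of the edges of the
`n`-fold subdivision of `E₁`. [folklore] -/
theorem edge_trans_left {y y' y'' : Y} (E₁ : Path y y') (E₂ : Path y' y'') {n J : ℕ}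
    (hn : 0 < n) (hJ : J < n) (s : I) : edge (E₁.trans E₂) (n * 2) J s = edge E₁ n J s := by
  have hn' : (0 : ℝ) < n := by exact_mod_cast hn
  have hcoe := coe_convexComb_gc_mul_two hn (by omega : J < n * 2) s
  change (E₁.trans E₂) _ = E₁ _
  rw [Path.trans_apply]
  have hle : ((Set.Icc.convexComb (gc (n * 2) J) (gc (n * 2) (J + 1)) s : I) : ℝ) ≤ 1 / 2 := by
    rw [hcoe, div_le_iff₀ (by positivity)]
    have hs1 := s.2.2
    have hJ' : (J : ℝ) + 1 ≤ n := by exact_mod_cast hJ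
    nlinarith
  rw [dif_pos hle]
  congr 1
  apply Subtype.ext
  change 2 * ((Set.Icc.convexComb (gc (n * 2) J) (gc (n * 2) (J + 1)) s : I) : ℝ) = _
  rw [hcoe, coe_convexComb_gc hn hJ]
  field_simp

/-- The second half of the `2n`-fold subdivision of `E₁ · E₂` consists of the edges of the
`n`-fold subdivision of `E₂`. [folklore] -/
theorem edge_trans_right {y y' y'' : Y} (E₁ : Path y y') (E₂ : Path y' y'') {n J : ℕ}
    (hn : 0 < n) (hJ : J < n) (s : I) :
    edge (E₁.trans E₂) (n * 2) (n + J) s = edge E₂ n J s := by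
  have hn' : (0 : ℝ) < n := by exact_mod_cast hn
  have hcoe := coe_convexComb_gc_mul_two hn (by omega : n + J < n * 2) s
  change (E₁.trans E₂) _ = E₂ _
  rw [Path.trans_apply]
  split_ifs with hle
  · -- boundary case `t = 1/2`: then `J = 0` and `s = 0`, both sides are `y'`
    rw [hcoe, div_le_iff₀ (by positivity)] at hle
    push_cast at hle
    have hs0 := s.2.1
    have hJ0 : (J : ℝ) ≤ 0 := by nlinarith
    have hJ0' : J = 0 := by exact_mod_cast le_antisymm hJ0 J.cast_nonneg
    subst hJ0'
    have hs : (s : ℝ) = 0 := by push_cast at hJ0; nlinarith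
    have key : ∀ u : I,
        (u : ℝ) = 2 * ((Set.Icc.convexComb (gc (n * 2) (n + 0)) (gc (n * 2) (n + 0 + 1)) s :
          I) : ℝ) → E₁ u = E₂ (Set.Icc.convexComb (gc n 0) (gc n (0 + 1)) s) := by
      intro u hu
      have hu1 : u = 1 := Subtype.ext (by
        rw [hu, hcoe, hs]
        push_cast
        field_simp
        ring)
      have e2 : (Set.Icc.convexComb (gc n 0) (gc n (0 + 1)) s : I) = 0 := Subtype.ext (by
        rw [coe_convexComb_gc hn hJ, hs]
        push_cast
        simp)
      rw [hu1, e2, E₁.target, E₂.source]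
    exact key _ rfl
  · congr 1
    apply Subtype.ext
    change 2 * ((Set.Icc.convexComb (gc (n * 2) (n + J)) (gc (n * 2) (n + J + 1)) s : I) : ℝ)
      - 1 = _
    rw [hcoe, coe_convexComb_gc hn hJ]
    push_cast
    field_simp
    ring

variable {D} in
/-- Admissible subdivisions of the factors give an admissible subdivision of the
concatenation. [folklore] -/
theorem Adm.trans {y y' y'' : Y} {E₁ : Path y y'} {E₂ : Path y' y''} {n : ℕ} (h₁ : D.Adm E₁ n)
    (h₂ : D.Adm E₂ n) : D.Adm (E₁.trans E₂) (n * 2) := by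
  refine ⟨Nat.mul_pos h₁.1 two_pos, fun J hJ => ?_⟩
  rcases Nat.lt_or_ge J n with hJn | hJn
  · rcases h₁.2 J hJn with h | h
    · exact Or.inl fun s => by rw [edge_trans_left E₁ E₂ h₁.1 hJn]; exact h s
    · exact Or.inr fun s => by rw [edge_trans_left E₁ E₂ h₁.1 hJn]; exact h s
  · obtain ⟨J, rfl⟩ : ∃ J', J = n + J' := ⟨J - n, by omega⟩
    have hJ' : J < n := by omega
    rcases h₂.2 J hJ' with h | h
    · exact Or.inl fun s => by rw [edge_trans_right E₁ E₂ h₁.1 hJ']; exact h s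
    · exact Or.inr fun s => by rw [edge_trans_right E₁ E₂ h₁.1 hJ']; exact h s

/-- **The label of a concatenation is the product of the labels** (reversed order).
[cite: HatcherAT2002, proof of Thm. 1.20] -/
theorem pathLabel_trans {y y' y'' : Y} (E₁ : Path y y') (E₂ : Path y' y'') :
    D.pathLabel (E₁.trans E₂) = D.pathLabel E₂ * D.pathLabel E₁ := by
  obtain ⟨n₁, h₁⟩ := D.exists_adm E₁
  obtain ⟨n₂, h₂⟩ := D.exists_adm E₂
  have h₁' : D.Adm E₁ (n₁ * n₂) := h₁.mul h₂.1
  have h₂' : D.Adm E₂ (n₁ * n₂) := by rw [Nat.mul_comm]; exact h₂.mul h₁.1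
  set n := n₁ * n₂ with hn
  have hn0 : 0 < n := h₁'.1
  rw [D.pathLabel_eq_pathProd (h₁'.trans h₂'), D.pathLabel_eq_pathProd h₁',
    D.pathLabel_eq_pathProd h₂', pathProd, Nat.mul_two, rowProd_add]
  congr 1
  · exact rowProd_congr n fun j hj => D.lab_congr_pt _ _ fun s =>
      (Nat.mul_two n) ▸ edge_trans_right E₁ E₂ hn0 hj s
  · exact rowProd_congr n fun j hj => D.lab_congr_pt _ _ fun s =>
      (Nat.mul_two n) ▸ edge_trans_left E₁ E₂ hn0 hj s

/-! ### The induced homomorphism `π₁(Y, x₀) → G` -/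

/-- The label of a homotopy class of paths. [folklore] -/
def classLabel {y y' : Y} : Path.Homotopic.Quotient y y' → G :=
  Quotient.lift (fun E => D.pathLabel E) fun _ _ h => D.pathLabel_eq_of_homotopic h

/-- The label of the class of a path is the label of the path. [folklore] -/
@[simp]
theorem classLabel_mk {y y' : Y} (E : Path y y') :
    D.classLabel (Path.Homotopic.Quotient.mk E) = D.pathLabel E := rfl

/-- Class labels are (anti-)multiplicative. [folklore] -/
theorem classLabel_trans {y y' y'' : Y} (p : Path.Homotopic.Quotient y y')
    (q : Path.Homotopic.Quotient y' y'') :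
    D.classLabel (p.trans q) = D.classLabel q * D.classLabel p := by
  induction p using Path.Homotopic.Quotient.ind with | mk E₁ =>
  induction q using Path.Homotopic.Quotient.ind with | mk E₂ =>
  rw [← Path.Homotopic.Quotient.mk_trans, classLabel_mk, classLabel_mk, classLabel_mk]
  exact D.pathLabel_trans E₁ E₂

/-- **The Seifert–van Kampen homomorphism** `Φ : π₁(Y, x₀) → G` of the datum: the class of a
loop `γ` goes to the product, along any admissible subdivision of `γ`, of the images under
`φ_U` / `φ_T` of the classes of the loops `conn · γ|[tⱼ, tⱼ₊₁] · conn⁻¹` of `U` / `T` (Hatcher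
(2002), proof of Thm. 1.20: the factorisations of `[γ]`). [cite: HatcherAT2002, Thm. 1.20] -/
def lift : _root_.FundamentalGroup Y D.x₀ →* G where
  toFun a := D.classLabel (_root_.FundamentalGroup.toPath a)
  map_one' := by
    change D.classLabel (Path.Homotopic.Quotient.mk (Path.refl D.x₀)) = 1
    rw [classLabel_mk]
    exact D.pathLabel_refl D.x₀
  map_mul' a b := by
    change D.classLabel ((_root_.FundamentalGroup.toPath b).trans
      (_root_.FundamentalGroup.toPath a)) = _
    exact D.classLabel_trans _ _

/-- The van Kampen homomorphism on the class of a loop is the label of the loop. [folklore] -/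
theorem lift_fromPath (γ : Path D.x₀ D.x₀) :
    D.lift (_root_.FundamentalGroup.fromPath (Path.Homotopic.Quotient.mk γ)) = D.pathLabel γ :=
  rfl

/-- Induction on `π₁` by representatives. [folklore] -/
theorem ind_fromPath {X : Type*} [TopologicalSpace X] {x : X}
    {motive : _root_.FundamentalGroup X x → Prop}
    (h : ∀ γ : Path x x, motive (_root_.FundamentalGroup.fromPath (Path.Homotopic.Quotient.mk γ)))
    (a : _root_.FundamentalGroup X x) : motive a :=
  Quotient.ind h a

/-- The van Kampen homomorphism on the class of a loop inside a piece is `φ` of the class of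
the loop in the piece. [folklore] -/
theorem lift_fromPath_of_subset (P : D.Piece) (hP : P = D.pieceU ∨ P = D.pieceT)
    (γ : Path D.x₀ D.x₀) (hγ : ∀ t, γ t ∈ P.S) :
    D.lift (_root_.FundamentalGroup.fromPath (Path.Homotopic.Quotient.mk γ)) =
      P.cls (liftPath P.S γ hγ) :=
  D.pathLabel_loop P hP γ hγ

/-- **Restriction to `π₁(U)`**: `Φ ∘ (i_U)_* = φ_U`. [cite: HatcherAT2002, Thm. 1.20] -/
theorem lift_inclHom_U (a : _root_.FundamentalGroup D.U ⟨D.x₀, D.hxU⟩) :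
    D.lift (inclHom D.U D.x₀ D.hxU a) = D.φU a := by
  induction a using ind_fromPath with
  | h δ =>
    rw [inclHom_fromPath, D.lift_fromPath_of_subset D.pieceU (Or.inl rfl) _ (fun t => (δ t).2)]
    change D.φU _ = D.φU _
    congr 3

/-- **Restriction to `π₁(T)`**: `Φ ∘ (i_T)_* = φ_T`. [cite: HatcherAT2002, Thm. 1.20] -/
theorem lift_inclHom_T (a : _root_.FundamentalGroup D.T ⟨D.x₀, D.hxT⟩) :
    D.lift (inclHom D.T D.x₀ D.hxT a) = D.φT a := by
  induction a using ind_fromPath with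
  | h δ =>
    rw [inclHom_fromPath, D.lift_fromPath_of_subset D.pieceT (Or.inr rfl) _ (fun t => (δ t).2)]
    change D.φT _ = D.φT _
    congr 3

/-- `Φ ∘ (i_U)_* = φ_U`, as homomorphisms. [folklore] -/
theorem lift_comp_inclHom_U : D.lift.comp (inclHom D.U D.x₀ D.hxU) = D.φU :=
  MonoidHom.ext D.lift_inclHom_U

/-- `Φ ∘ (i_T)_* = φ_T`, as homomorphisms. [folklore] -/
theorem lift_comp_inclHom_T : D.lift.comp (inclHom D.T D.x₀ D.hxT) = D.φT :=
  MonoidHom.ext D.lift_inclHom_T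

/-! ### Generation: every loop is a product of loops in `U` and in `T` -/

/-- The product of the classes of the loops `conn · E|[tⱼ, tⱼ₊₁] · conn⁻¹` of the first `k`
edges of a path (reversed order). [folklore] -/
def loopProd {y y' : Y} (E : Path y y') (n k : ℕ) : _root_.FundamentalGroup Y D.x₀ :=
  rowProd (fun _ j => _root_.FundamentalGroup.fromPath
    (Path.Homotopic.Quotient.mk (D.loop (edge E n j)))) 0 k

/-- **Telescoping in `Y`**: the product of the edge loops of the first `l` edges is the class
of `conn · E|[0, l/n] · conn⁻¹`. [folklore] -/
theorem loopProd_eq {y y' : Y} (E : Path y y') (n l : ℕ) :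
    D.loopProd E n l = _root_.FundamentalGroup.fromPath (Path.Homotopic.Quotient.mk
      ((D.conn (E (gc n 0))).trans ((E.subpath (gc n 0) (gc n l)).trans
        (D.conn (E (gc n l))).symm))) := by
  induction l with
  | zero =>
    rw [loopProd, rowProd_zero, Path.subpath_self, _root_.FundamentalGroup.one_def]
    simp only [_root_.FundamentalGroup.fromPath, _root_.FundamentalGroup.fromArrow,
      Path.Homotopic.Quotient.mk_trans, Path.Homotopic.Quotient.mk_symm,
      Path.Homotopic.Quotient.mk_refl, Path.Homotopic.Quotient.refl_trans,
      Path.Homotopic.Quotient.trans_symm]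
  | succ l ih =>
    rw [loopProd] at ih ⊢
    rw [rowProd_succ, ih, _root_.FundamentalGroup.mul_def]
    have hS : ∀ ρ : Path.Homotopic.Quotient (E (gc n (l + 1))) D.x₀,
        (Path.Homotopic.Quotient.mk (E.subpath (gc n 0) (gc n l))).trans
          ((Path.Homotopic.Quotient.mk (E.subpath (gc n l) (gc n (l + 1)))).trans ρ) =
        (Path.Homotopic.Quotient.mk (E.subpath (gc n 0) (gc n (l + 1)))).trans ρ := by
      intro ρ
      rw [← Path.Homotopic.Quotient.trans_assoc, ← Path.Homotopic.Quotient.mk_trans,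
        Path.Homotopic.Quotient.eq.2 ⟨Path.Homotopy.subpathTransSubpath E _ _ _⟩]
    unfold loop
    simp only [_root_.FundamentalGroup.fromPath, _root_.FundamentalGroup.fromArrow,
      Path.Homotopic.Quotient.mk_trans, Path.Homotopic.Quotient.mk_symm,
      Path.Homotopic.Quotient.trans_assoc, symm_trans_cancel, hS]

/-- Conjugating by the connecting paths of end points equal to the base point does nothing.
[folklore] -/
theorem mk_conn_trans_trans_conn_symm {w w' : Y} (δ : Path w w') (hw : D.x₀ = w)
    (hw' : D.x₀ = w') :
    Path.Homotopic.Quotient.mk ((D.conn w).trans (δ.trans (D.conn w').symm)) =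
      Path.Homotopic.Quotient.mk (δ.cast hw hw') := by
  subst hw hw'
  rw [D.conn_self, Path.refl_symm, Path.cast_rfl_rfl]
  simp only [Path.Homotopic.Quotient.mk_trans, Path.Homotopic.Quotient.mk_refl,
    Path.Homotopic.Quotient.refl_trans, Path.Homotopic.Quotient.trans_refl]

/-- **Every loop is the product of its edge loops.** [cite: HatcherAT2002, proof of Lemma 1.15] -/
theorem loopProd_self (γ : Path D.x₀ D.x₀) {n : ℕ} (hn : 0 < n) :
    D.loopProd γ n n = _root_.FundamentalGroup.fromPath (Path.Homotopic.Quotient.mk γ) := by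
  rw [D.loopProd_eq γ n n]
  have key : ∀ (t₀ t₁ : I) (h0 : t₀ = 0) (h1 : t₁ = 1),
      Path.Homotopic.Quotient.mk ((D.conn (γ t₀)).trans ((γ.subpath t₀ t₁).trans
        (D.conn (γ t₁)).symm)) = Path.Homotopic.Quotient.mk γ := by
    intro t₀ t₁ h0 h1
    subst h0 h1
    rw [D.mk_conn_trans_trans_conn_symm _ γ.source.symm γ.target.symm]
    congr 1
    ext t
    rw [Path.cast_coe, Path.subpath_zero_one, Path.cast_coe]
  exact congrArg _root_.FundamentalGroup.fromPath (key _ _ (gc_zero n) (gc_self hn))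

/-- The class of the loop of an edge inside a piece is in the image of `π₁` of that piece.
[folklore] -/
theorem fromPath_loop_mem_range {y y' : Y} (E : Path y y')
    (hE : (∀ t, E t ∈ D.U) ∨ (∀ t, E t ∈ D.T)) :
    _root_.FundamentalGroup.fromPath (Path.Homotopic.Quotient.mk (D.loop E)) ∈
      Set.range (inclHom D.U D.x₀ D.hxU) ∪ Set.range (inclHom D.T D.x₀ D.hxT) := by
  rcases hE with hU | hT
  · exact Or.inl ⟨_, inclHom_fromPath_liftPath D.hxU (D.loop E) (D.loop_mem_U E hU)⟩
  · exact Or.inr ⟨_, inclHom_fromPath_liftPath D.hxT (D.loop E) (D.loop_mem_T E hT)⟩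

/-- **Generation half of van Kampen's theorem** (Hatcher (2002), Lemma 1.15 for two sets):
`π₁(Y, x₀)` is generated by the images of `π₁(U, x₀)` and `π₁(T, x₀)`. [cite: HatcherAT2002, Lemma 1.15] -/
theorem closure_range_inclHom_eq_top :
    Subgroup.closure (Set.range (inclHom D.U D.x₀ D.hxU) ∪ Set.range (inclHom D.T D.x₀ D.hxT)) =
      ⊤ := by
  rw [eq_top_iff]
  intro a _
  induction a using ind_fromPath with
  | h γ =>
    obtain ⟨n, hn⟩ := D.exists_adm γ
    rw [← D.loopProd_self γ hn.1]
    have : ∀ k, k ≤ n → D.loopProd γ n k ∈ Subgroup.closure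
        (Set.range (inclHom D.U D.x₀ D.hxU) ∪ Set.range (inclHom D.T D.x₀ D.hxT)) := by
      intro k
      induction k with
      | zero => intro; exact Subgroup.one_mem _
      | succ k ih =>
        intro hk
        rw [loopProd, rowProd_succ]
        exact Subgroup.mul_mem _ (Subgroup.subset_closure
          (D.fromPath_loop_mem_range _ (hn.2 k hk))) (ih (Nat.le_of_succ_le hk))
    exact this n le_rfl

/-- **Uniqueness half**: two homomorphisms on `π₁(Y, x₀)` that agree on the images of `π₁(U)`
and `π₁(T)` are equal. [cite: HatcherAT2002, Thm. 1.20] -/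
theorem hom_ext {K : Type*} [Group K] {Φ Ψ : _root_.FundamentalGroup Y D.x₀ →* K}
    (hU : Φ.comp (inclHom D.U D.x₀ D.hxU) = Ψ.comp (inclHom D.U D.x₀ D.hxU))
    (hT : Φ.comp (inclHom D.T D.x₀ D.hxT) = Ψ.comp (inclHom D.T D.x₀ D.hxT)) : Φ = Ψ := by
  refine MonoidHom.eq_of_eqOn_dense D.closure_range_inclHom_eq_top ?_
  rintro _ (⟨a, rfl⟩ | ⟨a, rfl⟩)
  · exact DFunLike.congr_fun hU a
  · exact DFunLike.congr_fun hT a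

/-- **The universal property (Seifert–van Kampen theorem, pushout form).** The van Kampen
homomorphism is the unique homomorphism `π₁(Y, x₀) → G` restricting to `φ_U` on `π₁(U)` and to
`φ_T` on `π₁(T)`; i.e. `π₁(Y, x₀)` with `(i_U)_*, (i_T)_*` is the pushout of
`π₁(U, x₀) ← π₁(U ∩ T, x₀) → π₁(T, x₀)` in the category of groups. [cite: HatcherAT2002, Thm. 1.20] -/
theorem lift_unique (Φ : _root_.FundamentalGroup Y D.x₀ →* G)
    (hU : Φ.comp (inclHom D.U D.x₀ D.hxU) = D.φU) (hT : Φ.comp (inclHom D.T D.x₀ D.hxT) = D.φT) :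
    Φ = D.lift :=
  D.hom_ext (hU.trans D.lift_comp_inclHom_U.symm) (hT.trans D.lift_comp_inclHom_T.symm)

/-- **Existence and uniqueness** in one statement. [cite: HatcherAT2002, Thm. 1.20] -/
theorem existsUnique_hom :
    ∃! Φ : _root_.FundamentalGroup Y D.x₀ →* G,
      Φ.comp (inclHom D.U D.x₀ D.hxU) = D.φU ∧ Φ.comp (inclHom D.T D.x₀ D.hxT) = D.φT :=
  ⟨D.lift, ⟨D.lift_comp_inclHom_U, D.lift_comp_inclHom_T⟩,
    fun Φ h => D.lift_unique Φ h.1 h.2⟩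

end PushoutData

/-! ### Unbundled statements -/

section Unbundled

variable {U T : Set Y} {x₀ : Y}

/-- **The tautological datum** of an open cover: `G = π₁(Y, x₀)` and the homomorphisms induced
by the inclusions. [folklore] -/
def PushoutData.ofCover (hUo : IsOpen U) (hTo : IsOpen T) (hcov : U ∪ T = univ) (hxU : x₀ ∈ U)
    (hxT : x₀ ∈ T) (hUpc : IsPathConnected U) (hTpc : IsPathConnected T)
    (hmeet : IsPathConnected (U ∩ T)) : PushoutData Y (_root_.FundamentalGroup Y x₀) where
  U := U
  T := T
  hUo := hUo
  hTo := hTo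
  hcov := hcov
  x₀ := x₀
  hxU := hxU
  hxT := hxT
  hUpc := hUpc
  hTpc := hTpc
  hmeet := hmeet
  φU := inclHom U x₀ hxU
  φT := inclHom T x₀ hxT
  compat δ hU hT := by rw [inclHom_fromPath_liftPath, inclHom_fromPath_liftPath]

/-- **Generation** (Hatcher (2002), Lemma 1.15, two open sets): if `Y = U ∪ T` with `U`, `T`
open, `x₀ ∈ U ∩ T` and `U`, `T`, `U ∩ T` path connected, then `π₁(Y, x₀)` is generated by the
images of `π₁(U, x₀)` and `π₁(T, x₀)`. [cite: HatcherAT2002, Lemma 1.15] -/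
theorem closure_range_inclHom_union_eq_top (hUo : IsOpen U) (hTo : IsOpen T)
    (hcov : U ∪ T = univ) (hxU : x₀ ∈ U) (hxT : x₀ ∈ T) (hUpc : IsPathConnected U)
    (hTpc : IsPathConnected T) (hmeet : IsPathConnected (U ∩ T)) :
    Subgroup.closure (Set.range (inclHom U x₀ hxU) ∪ Set.range (inclHom T x₀ hxT)) = ⊤ :=
  (PushoutData.ofCover hUo hTo hcov hxU hxT hUpc hTpc hmeet).closure_range_inclHom_eq_top

/-- **Seifert–van Kampen theorem, universal-property form** (Hatcher, *Algebraic Topology*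
(2002), Thm. 1.20, two open sets). Let `Y = U ∪ T` with `U`, `T` open, `x₀ ∈ U ∩ T` and `U`,
`T`, `U ∩ T` path connected. For every group `G` and homomorphisms `φ_U : π₁(U, x₀) → G`,
`φ_T : π₁(T, x₀) → G` that agree on the classes of the loops at `x₀` inside `U ∩ T`, there is
a unique homomorphism `Φ : π₁(Y, x₀) → G` with `Φ ∘ (i_U)_* = φ_U` and `Φ ∘ (i_T)_* = φ_T`.
(Thus `π₁(Y) ≅ π₁(U) *_{π₁(U ∩ T)} π₁(T)`.) [cite: HatcherAT2002, Thm. 1.20] -/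
theorem existsUnique_hom_of_cover (hUo : IsOpen U) (hTo : IsOpen T) (hcov : U ∪ T = univ)
    (hxU : x₀ ∈ U) (hxT : x₀ ∈ T) (hUpc : IsPathConnected U) (hTpc : IsPathConnected T)
    (hmeet : IsPathConnected (U ∩ T))
    (φU : _root_.FundamentalGroup U ⟨x₀, hxU⟩ →* G) (φT : _root_.FundamentalGroup T ⟨x₀, hxT⟩ →* G)
    (compat : ∀ (δ : Path x₀ x₀) (hU : ∀ t, δ t ∈ U) (hT : ∀ t, δ t ∈ T),
      φU (_root_.FundamentalGroup.fromPath (Path.Homotopic.Quotient.mk (liftPath U δ hU))) =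
        φT (_root_.FundamentalGroup.fromPath (Path.Homotopic.Quotient.mk (liftPath T δ hT)))) :
    ∃! Φ : _root_.FundamentalGroup Y x₀ →* G,
      Φ.comp (inclHom U x₀ hxU) = φU ∧ Φ.comp (inclHom T x₀ hxT) = φT :=
  (PushoutData.mk U T hUo hTo hcov x₀ hxU hxT hUpc hTpc hmeet φU φT compat).existsUnique_hom

end Unbundled

/-! ### Simply connected intersection: the free-product form -/

section Coprod

variable {U T : Set Y} {x₀ : Y}

/-- A loop at `x₀` inside a simply connected `U ∩ T` has trivial class in `π₁(S)` for every
`S ⊇ U ∩ T`. [folklore] -/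
theorem fromPath_liftPath_eq_one_of_isSimplyConnected (hsc : IsSimplyConnected (U ∩ T))
    {S : Set Y} (hS : U ∩ T ⊆ S) (hxS : x₀ ∈ S) (δ : Path x₀ x₀) (hU : ∀ t, δ t ∈ U)
    (hT : ∀ t, δ t ∈ T) (hδS : ∀ t, δ t ∈ S) :
    (_root_.FundamentalGroup.fromPath (Path.Homotopic.Quotient.mk (liftPath S δ hδS)) :
      _root_.FundamentalGroup S ⟨x₀, hxS⟩) = 1 := by
  obtain ⟨-, h⟩ := isSimplyConnected_iff_exists_homotopy_refl_forall_mem.1 hsc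
  obtain ⟨F, hF⟩ := h x₀ δ fun t => ⟨hU t, hT t⟩
  have hw : HomotopicWithin S δ (Path.refl x₀) := ⟨F, fun t => hS (hF t)⟩
  have hl : (liftPath S δ hδS).Homotopic (liftPath S (Path.refl x₀) fun _ => hxS) :=
    hw.liftPath hδS fun _ => hxS
  have hrefl : liftPath S (Path.refl x₀) (fun _ => hxS) = Path.refl (⟨x₀, hxS⟩ : S) := by
    ext t
    rfl
  rw [_root_.FundamentalGroup.one_def, ← Path.Homotopic.Quotient.mk_refl, ← hrefl]
  exact congrArg _root_.FundamentalGroup.fromPath (Path.Homotopic.Quotient.eq.2 hl)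

/-- **The free-product datum**: `G = π₁(U, x₀) ∗ π₁(T, x₀)` with the two canonical injections,
compatible because `U ∩ T` is simply connected. [folklore] -/
def PushoutData.coprod (hUo : IsOpen U) (hTo : IsOpen T) (hcov : U ∪ T = univ)
    (hxU : x₀ ∈ U) (hxT : x₀ ∈ T) (hUpc : IsPathConnected U) (hTpc : IsPathConnected T)
    (hsc : IsSimplyConnected (U ∩ T)) :
    PushoutData Y (Monoid.Coprod (_root_.FundamentalGroup U ⟨x₀, hxU⟩)
      (_root_.FundamentalGroup T ⟨x₀, hxT⟩)) where
  U := U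
  T := T
  hUo := hUo
  hTo := hTo
  hcov := hcov
  x₀ := x₀
  hxU := hxU
  hxT := hxT
  hUpc := hUpc
  hTpc := hTpc
  hmeet := hsc.isPathConnected
  φU := Monoid.Coprod.inl
  φT := Monoid.Coprod.inr
  compat δ hU hT := by
    rw [fromPath_liftPath_eq_one_of_isSimplyConnected hsc inter_subset_left hxU δ hU hT hU,
      fromPath_liftPath_eq_one_of_isSimplyConnected hsc inter_subset_right hxT δ hU hT hT,
      map_one, map_one]

/-- The van Kampen homomorphism of the free-product datum on a class from `U`. [folklore] -/
theorem coprod_lift_inclHom_U (hUo : IsOpen U) (hTo : IsOpen T) (hcov : U ∪ T = univ)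
    (hxU : x₀ ∈ U) (hxT : x₀ ∈ T) (hUpc : IsPathConnected U) (hTpc : IsPathConnected T)
    (hsc : IsSimplyConnected (U ∩ T)) (a : _root_.FundamentalGroup U ⟨x₀, hxU⟩) :
    (PushoutData.coprod hUo hTo hcov hxU hxT hUpc hTpc hsc).lift (inclHom U x₀ hxU a) =
      Monoid.Coprod.inl a :=
  (PushoutData.coprod hUo hTo hcov hxU hxT hUpc hTpc hsc).lift_inclHom_U a

/-- The van Kampen homomorphism of the free-product datum on a class from `T`. [folklore] -/
theorem coprod_lift_inclHom_T (hUo : IsOpen U) (hTo : IsOpen T) (hcov : U ∪ T = univ)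
    (hxU : x₀ ∈ U) (hxT : x₀ ∈ T) (hUpc : IsPathConnected U) (hTpc : IsPathConnected T)
    (hsc : IsSimplyConnected (U ∩ T)) (a : _root_.FundamentalGroup T ⟨x₀, hxT⟩) :
    (PushoutData.coprod hUo hTo hcov hxU hxT hUpc hTpc hsc).lift (inclHom T x₀ hxT a) =
      Monoid.Coprod.inr a :=
  (PushoutData.coprod hUo hTo hcov hxU hxT hUpc hTpc hsc).lift_inclHom_T a

/-- `(i_U)_* ∗ (i_T)_*` is a left inverse of the van Kampen homomorphism of the free-product
datum (uniqueness half of van Kampen). [folklore] -/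
theorem coprodLift_comp_lift (hUo : IsOpen U) (hTo : IsOpen T) (hcov : U ∪ T = univ)
    (hxU : x₀ ∈ U) (hxT : x₀ ∈ T) (hUpc : IsPathConnected U) (hTpc : IsPathConnected T)
    (hsc : IsSimplyConnected (U ∩ T)) :
    (Monoid.Coprod.lift (inclHom U x₀ hxU) (inclHom T x₀ hxT)).comp
        (PushoutData.coprod hUo hTo hcov hxU hxT hUpc hTpc hsc).lift =
      MonoidHom.id (_root_.FundamentalGroup Y x₀) := by
  refine (PushoutData.coprod hUo hTo hcov hxU hxT hUpc hTpc hsc).hom_ext ?_ ?_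
  · ext a
    change Monoid.Coprod.lift (inclHom U x₀ hxU) (inclHom T x₀ hxT)
      ((PushoutData.coprod hUo hTo hcov hxU hxT hUpc hTpc hsc).lift (inclHom U x₀ hxU a)) =
      inclHom U x₀ hxU a
    rw [coprod_lift_inclHom_U, Monoid.Coprod.lift_apply_inl]
  · ext a
    change Monoid.Coprod.lift (inclHom U x₀ hxU) (inclHom T x₀ hxT)
      ((PushoutData.coprod hUo hTo hcov hxU hxT hUpc hTpc hsc).lift (inclHom T x₀ hxT a)) =
      inclHom T x₀ hxT a
    rw [coprod_lift_inclHom_T, Monoid.Coprod.lift_apply_inr]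

/-- `(i_U)_* ∗ (i_T)_*` is a right inverse of the van Kampen homomorphism of the free-product
datum (restriction property). [folklore] -/
theorem lift_comp_coprodLift (hUo : IsOpen U) (hTo : IsOpen T) (hcov : U ∪ T = univ)
    (hxU : x₀ ∈ U) (hxT : x₀ ∈ T) (hUpc : IsPathConnected U) (hTpc : IsPathConnected T)
    (hsc : IsSimplyConnected (U ∩ T)) :
    (PushoutData.coprod hUo hTo hcov hxU hxT hUpc hTpc hsc).lift.comp
        (Monoid.Coprod.lift (inclHom U x₀ hxU) (inclHom T x₀ hxT)) =
      MonoidHom.id _ :=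
  Monoid.Coprod.hom_ext
    (MonoidHom.ext fun a => by
      change (PushoutData.coprod hUo hTo hcov hxU hxT hUpc hTpc hsc).lift
        (Monoid.Coprod.lift (inclHom U x₀ hxU) (inclHom T x₀ hxT) (Monoid.Coprod.inl a)) =
        Monoid.Coprod.inl a
      rw [Monoid.Coprod.lift_apply_inl, coprod_lift_inclHom_U])
    (MonoidHom.ext fun a => by
      change (PushoutData.coprod hUo hTo hcov hxU hxT hUpc hTpc hsc).lift
        (Monoid.Coprod.lift (inclHom U x₀ hxU) (inclHom T x₀ hxT) (Monoid.Coprod.inr a)) =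
        Monoid.Coprod.inr a
      rw [Monoid.Coprod.lift_apply_inr, coprod_lift_inclHom_T])

/-- **Seifert–van Kampen theorem, free-product form** (Hatcher, *Algebraic Topology* (2002),
Thm. 1.20 with `π₁(U ∩ T) = 1`). Let `Y = U ∪ T` with `U`, `T` open and path connected,
`x₀ ∈ U ∩ T`, and `U ∩ T` simply connected. Then the inclusions induce an isomorphism
`π₁(Y, x₀) ≅ π₁(U, x₀) ∗ π₁(T, x₀)` onto the free product. [cite: HatcherAT2002, Thm. 1.20] -/
def fundamentalGroupEquivCoprod (hUo : IsOpen U) (hTo : IsOpen T) (hcov : U ∪ T = univ)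
    (hxU : x₀ ∈ U) (hxT : x₀ ∈ T) (hUpc : IsPathConnected U) (hTpc : IsPathConnected T)
    (hsc : IsSimplyConnected (U ∩ T)) :
    _root_.FundamentalGroup Y x₀ ≃*
      Monoid.Coprod (_root_.FundamentalGroup U ⟨x₀, hxU⟩) (_root_.FundamentalGroup T ⟨x₀, hxT⟩) :=
  MonoidHom.toMulEquiv (PushoutData.coprod hUo hTo hcov hxU hxT hUpc hTpc hsc).lift
    (Monoid.Coprod.lift (inclHom U x₀ hxU) (inclHom T x₀ hxT))
    (coprodLift_comp_lift hUo hTo hcov hxU hxT hUpc hTpc hsc)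
    (lift_comp_coprodLift hUo hTo hcov hxU hxT hUpc hTpc hsc)

/-- The van Kampen isomorphism sends the class of a loop in `U` to the left factor.
[folklore] -/
@[simp]
theorem fundamentalGroupEquivCoprod_inclHom_left (hUo : IsOpen U) (hTo : IsOpen T)
    (hcov : U ∪ T = univ) (hxU : x₀ ∈ U) (hxT : x₀ ∈ T) (hUpc : IsPathConnected U)
    (hTpc : IsPathConnected T) (hsc : IsSimplyConnected (U ∩ T))
    (a : _root_.FundamentalGroup U ⟨x₀, hxU⟩) :
    fundamentalGroupEquivCoprod hUo hTo hcov hxU hxT hUpc hTpc hsc (inclHom U x₀ hxU a) =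
      Monoid.Coprod.inl a :=
  coprod_lift_inclHom_U hUo hTo hcov hxU hxT hUpc hTpc hsc a

/-- The van Kampen isomorphism sends the class of a loop in `T` to the right factor.
[folklore] -/
@[simp]
theorem fundamentalGroupEquivCoprod_inclHom_right (hUo : IsOpen U) (hTo : IsOpen T)
    (hcov : U ∪ T = univ) (hxU : x₀ ∈ U) (hxT : x₀ ∈ T) (hUpc : IsPathConnected U)
    (hTpc : IsPathConnected T) (hsc : IsSimplyConnected (U ∩ T))
    (a : _root_.FundamentalGroup T ⟨x₀, hxT⟩) :
    fundamentalGroupEquivCoprod hUo hTo hcov hxU hxT hUpc hTpc hsc (inclHom T x₀ hxT a) =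
      Monoid.Coprod.inr a :=
  coprod_lift_inclHom_T hUo hTo hcov hxU hxT hUpc hTpc hsc a

/-- The inverse of the van Kampen isomorphism on the left factor is `(i_U)_*`. [folklore] -/
@[simp]
theorem fundamentalGroupEquivCoprod_symm_inl (hUo : IsOpen U) (hTo : IsOpen T)
    (hcov : U ∪ T = univ) (hxU : x₀ ∈ U) (hxT : x₀ ∈ T) (hUpc : IsPathConnected U)
    (hTpc : IsPathConnected T) (hsc : IsSimplyConnected (U ∩ T))
    (a : _root_.FundamentalGroup U ⟨x₀, hxU⟩) :
    (fundamentalGroupEquivCoprod hUo hTo hcov hxU hxT hUpc hTpc hsc).symm (Monoid.Coprod.inl a) =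
      inclHom U x₀ hxU a :=
  Monoid.Coprod.lift_apply_inl (inclHom U x₀ hxU) (inclHom T x₀ hxT) a

/-- The inverse of the van Kampen isomorphism on the right factor is `(i_T)_*`. [folklore] -/
@[simp]
theorem fundamentalGroupEquivCoprod_symm_inr (hUo : IsOpen U) (hTo : IsOpen T)
    (hcov : U ∪ T = univ) (hxU : x₀ ∈ U) (hxT : x₀ ∈ T) (hUpc : IsPathConnected U)
    (hTpc : IsPathConnected T) (hsc : IsSimplyConnected (U ∩ T))
    (a : _root_.FundamentalGroup T ⟨x₀, hxT⟩) :
    (fundamentalGroupEquivCoprod hUo hTo hcov hxU hxT hUpc hTpc hsc).symm (Monoid.Coprod.inr a) =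
      inclHom T x₀ hxT a :=
  Monoid.Coprod.lift_apply_inr (inclHom U x₀ hxU) (inclHom T x₀ hxT) a

end Coprod

end VanKampen

end Literature.AlgebraicTopology.FundamentalGroup
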